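import Literature.NumberTheory.Automorphic.UnitaryCayleyChartDatumTorus      -- ★ p840321 A-p16: torus-coordinate form (field level) over ★ p840200
import Literature.NumberTheory.Automorphic.ChartDatumProdTransport           -- ★ A-p16: transport ∕ product ∕ re-coordinatisation (generic)
import Literature.NumberTheory.Automorphic.OrbitalMeasureCanonicalExistsCM   -- ★ p839410: `charpoly_separable_localNonsplitEquiv_of_isRegularElt`
import Literature.NumberTheory.Automorphic.LocalEndoscopicOrbitClosed        -- ★ `IsGRegular.isRegularElt_fst`, `gl_fin_one_comm`
import Literature.NumberTheory.Automorphic.AdicCompletionCompact             -- ★ `properSpace_adicCompletion`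
import Literature.NumberTheory.Rogawski1990.LocalTransferGlueCM              -- ★ p839896 F0P2-p02: `totallyDisconnectedSpace_cmDatum_local` (+ `LocalTransfer` carriers)
import Literature.NumberTheory.Rogawski1990.EndoscopicClassTransfer          -- ★ `isStablyConj_iff_eq_of_fin_one`
import HarnessLib

/-!
# Regular orbit charts on `H(L⁺_v) = U(Φ₂)(L⁺_v) × U(Φ₁)(L⁺_v)` and on `U(H′)(L⁺_v)` at a NON-SPLIT place, in TORUS COORDINATES, with the
# `G`-regular ∕ regular, saturated and STABLY SEPARATED compact-open boxes (N6ns-reg-(iv) CM DRESS — FILE 2, the CM instantiation)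

Topic `NumberTheory/Rogawski1990`; namespace `Literature.NumberTheory.Rogawski1990`. THEOREMS ONLY (no definition, no instance, no notation, no named fact, no
`sorry`). Cell `pub/hodgecm-mathlib` (D-0151), crux H413 = stmt-HodgeConjecture-24833, F0∕P3a road «N6-ns», brick **N6ns-reg-(iv) CM DRESS** (LEAD F0P3a-plan (g9)
T8-19 (D)(3), T8-25 (J-a); F0P2-p02 (g8) feeder spec 02:43:45Z «(2ᵀ) … at EVERY base point … and the same head for `G′_v`»). Consumer: F0P2-p02's
`Rogawski1990/LocalTransferChartJunctionCM.lean` ((HLOC) junction) through ★ p840111 `OrbitalIntegralChartRealisation` (binders `e s hs τ he hKB hreg hsat` + `hsep`).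

THE CHAIN (all ★, no new mathematics here): at a non-split `v` (`w ∣ v`, `w̄ = w`) the one-place model ★ `localNonsplitEquiv : U(J)(L⁺_v) ≃ₜ* U(σ_w, J_w)(L_w)`;
`L_w` is a complete, proper, totally disconnected non-trivially normed field of characteristic `0` (Mathlib `Valued.toNontriviallyNormedField`, ★
`properSpace_adicCompletion`, ★ `Valued.totallyDisconnectedSpace'`); the field-level Cayley chart datum ★ p840200 `exists_unitary_cayleyChartDatum` at the regular
image point, put in torus coordinates by ★ p840321 `exists_torus_chartDatum_of_chartDatum`, transported back along `localNonsplitEquiv⁻¹` (★ `exists_chartDatum_transport`,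
the STABLE relation `IsStablyConj` = `GL`-conjugacy over `∏_{w′∣v} L_{w′}` mapped to `GL`-conjugacy over `L_w` by the evaluation homomorphism), then — for `H` — multiplied
by the abelian factor `U(Φ₁)(L⁺_v)` (★ `exists_chartDatum_prod`, `IsLocalStablyConjH = IsStablyConj × (=)` by ★ `isStablyConj_iff_eq_of_fin_one`, the OPEN
`G`-regular locus shrunk into), and finally re-coordinatised onto the centraliser SUBGROUP of the base point (★ `exists_chartDatum_recoord`,
★ `exists_homeomorph_centralizer_map` ∕ `_prod`).

* §1 `isRegularElt_iff_charpoly_localNonsplitEquiv`, `isOpen_setOf_isRegularElt_cmDatum_local`, `isOpen_setOf_isLocalGRegular` — the regular loci are OPEN at a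
  non-split place (★ `isOpen_setOf_charpoly_separable` over the field `L_w`); `isConj_localNonsplitEquiv_of_isStablyConj` — the stable relation in the one-place model.
* §2 **`exists_chartDatum_cmDatum_local_centralizer`** — the torus-coordinate chart datum on `U(H′)(L⁺_v)` at every REGULAR `γ₀′` (any hermitian `H′` with
  `det H′ ≠ 0`; (reg) = `IsRegularElt`, (SEP) for `IsStablyConj`).
* §3 **`exists_chartDatum_H_local_centralizer`** — the torus-coordinate chart datum on `H_v` at every `G`-REGULAR `γH` ((reg) = `IsLocalGRegular L v`,
  `T = Z_{H_v}(γH)`, (SEP) for `IsLocalStablyConjH L v`).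
* §4 the consumer's binder shapes verbatim: `exists_chartDatum_cmDatum_local_centralizer_regular_sep` (= `hNG` data: regular + `IsConj`-separated shrinking boxes,
  `s(a₀) = 1`) and `forall_isLocalGRegular_exists_chartDatum_H_local_centralizer` (= `hchartH`: one compact-open box per `G`-regular `γH`).

HONEST SCOPE. Point-set topology of the tree's carriers; no measure, no orbital integral. HC_CM is proved only modulo the printed citations until rung 0 closes; this
file discharges no printed statement (it is the `H`-side ∕ `G′`-side chart input of the non-split transfer-by-charts road, [Rogawski1990] §4.9 Prop. 4.9.1 (a)).

## References
* [Rogawski1990] J. D. Rogawski, *Automorphic Representations of Unitary Groups in Three Variables*, Ann. of Math. Stud. 123 (1990), §3.1 p. 19 (stable conjugacy),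
  §4.3 p. 43, §4.9 p. 54 (transfer at non-split places through the regular set).
* [HarishChandra1970] Harish-Chandra (notes by G. van Dijk), *Harmonic Analysis on Reductive p-adic Groups*, LNM 162 (1970), Part I §3.
* [PlatonovRapinchuk1994] V. Platonov, A. Rapinchuk, *Algebraic Groups and Number Theory* (1994), §3.3 (topology of `G(F_v)`), §5.1.
-/

set_option autoImplicit false

noncomputable section

open Set Filter Topology Polynomial NumberField IsDedekindDomain
open Literature.NumberTheory.Automorphic Literature.NumberTheory.Automorphic.UnitaryGroup
open scoped Matrix MatrixGroups Pointwise

namespace Literature.NumberTheory.Rogawski1990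

variable (L : Type) [Field L] [NumberField L] [IsCMField L] {v : HeightOneSpectrum (𝓞 ↥(maximalRealSubfield L))}

/-! ## §1 The regular loci are open at a non-split place; the stable relation in the one-place model -/

section RegularOpen

variable {N : ℕ} (H : Matrix (Fin N) (Fin N) L)

/-- At a non-split place, `γ ∈ U(H)(L⁺_v)` is regular semisimple iff its one-place image in `GL_N(L_w)` has separable characteristic polynomial (`∏_{w′ ∣ v} L_{w′} = L_w`:
evaluation at the unique `w` is a ring isomorphism). [cite: Rogawski1990, §3.1 p. 19] [cite: PlatonovRapinchuk1994, §5.1] -/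
theorem isRegularElt_iff_charpoly_localNonsplitEquiv (w : PlacesOver L v) (hw : IsCMField.complexConj L • w.1 = w.1) (γ : (cmDatum L N H).Local v) :
    IsRegularElt (γ.val : GL (Fin N) (LocalRing L v)) ↔
      ((((localNonsplitEquiv (IsCMField.complexConj L) H (IsCMField.complexConj_ne_one L) w hw γ :
          unitaryGroupOfForm (galAdicCompletionMap (L := L) (IsCMField.complexConj L) hw) (placeForm H w.1)) :
          GL (Fin N) (w.1.adicCompletion L)) : Matrix (Fin N) (Fin N) (w.1.adicCompletion L)).charpoly).Separable := by
  refine ⟨charpoly_separable_localNonsplitEquiv_of_isRegularElt (IsCMField.complexConj L) N H (IsCMField.complexConj_ne_one L) γ w hw, fun h => ?_⟩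
  have hcoe : ((((localNonsplitEquiv (IsCMField.complexConj L) H (IsCMField.complexConj_ne_one L) w hw γ :
          unitaryGroupOfForm (galAdicCompletionMap (L := L) (IsCMField.complexConj L) hw) (placeForm H w.1)) :
          GL (Fin N) (w.1.adicCompletion L)) : Matrix (Fin N) (Fin N) (w.1.adicCompletion L)).charpoly) =
      (((γ.val : GL (Fin N) (LocalRing L v)) : Matrix (Fin N) (Fin N) (LocalRing L v)).charpoly).map
        (Pi.evalRingHom (fun w' : PlacesOver L v => w'.1.adicCompletion L) w) := by
    rw [← Matrix.charpoly_map]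
    rfl
  rw [hcoe] at h
  letI : Unique (PlacesOver L v) :=
    @uniqueOfSubsingleton _ (PlacesOver.subsingleton_of_smul_eq (IsCMField.complexConj L) (IsCMField.complexConj_ne_one L) w hw) w
  let ψ : LocalRing L v ≃+* w.1.adicCompletion L := RingEquiv.piUnique fun w' : PlacesOver L v => w'.1.adicCompletion L
  have hψ : (Pi.evalRingHom (fun w' : PlacesOver L v => w'.1.adicCompletion L) w : LocalRing L v →+* w.1.adicCompletion L) = ψ.toRingHom :=
    RingHom.ext fun _ => rfl
  rw [hψ] at h
  have h2 := h.map (f := ψ.symm.toRingHom)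
  rw [Polynomial.map_map, RingEquiv.symm_toRingHom_comp_toRingHom, Polynomial.map_id] at h2
  exact h2

/-- **The regular locus of `U(H)(L⁺_v)` is OPEN** at a non-split place (★ `isOpen_setOf_charpoly_separable` over the field `L_w`, pulled back along the
continuous one-place model). [cite: Rogawski1990, §3.1 p. 19] [cite: PlatonovRapinchuk1994, §3.3] -/
theorem isOpen_setOf_isRegularElt_cmDatum_local (w : PlacesOver L v) (hw : IsCMField.complexConj L • w.1 = w.1) :
    IsOpen {γ : (cmDatum L N H).Local v | IsRegularElt (γ.val : GL (Fin N) (LocalRing L v))} := by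
  have hset : {γ : (cmDatum L N H).Local v | IsRegularElt (γ.val : GL (Fin N) (LocalRing L v))} =
      (fun γ : (cmDatum L N H).Local v =>
        (((localNonsplitEquiv (IsCMField.complexConj L) H (IsCMField.complexConj_ne_one L) w hw γ :
            unitaryGroupOfForm (galAdicCompletionMap (L := L) (IsCMField.complexConj L) hw) (placeForm H w.1)) :
            GL (Fin N) (w.1.adicCompletion L)) : Matrix (Fin N) (Fin N) (w.1.adicCompletion L))) ⁻¹'
        {x : Matrix (Fin N) (Fin N) (w.1.adicCompletion L) | x.charpoly.Separable} := by
    ext γ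
    exact isRegularElt_iff_charpoly_localNonsplitEquiv L H w hw γ
  rw [hset]
  exact Literature.LinearAlgebra.Matrix.isOpen_setOf_charpoly_separable.preimage
    (Units.continuous_val.comp (continuous_subtype_val.comp
      (localNonsplitEquiv (IsCMField.complexConj L) H (IsCMField.complexConj_ne_one L) w hw).continuous))

/-- **Stable conjugacy in the one-place model**: `γ ∼_st δ` in `U(H)(L⁺_v)` (`GL_N(∏_{w′∣v} L_{w′})`-conjugacy) ⇒ their one-place images are `GL_N(L_w)`-conjugate
(the evaluation homomorphism). [cite: Rogawski1990, §3.1 p. 19] [cite: PlatonovRapinchuk1994, §5.1] -/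
theorem isConj_localNonsplitEquiv_of_isStablyConj (w : PlacesOver L v) (hw : IsCMField.complexConj L • w.1 = w.1) {γ δ : (cmDatum L N H).Local v}
    (h : IsStablyConj (conjLocal L (IsCMField.complexConj L) v) ((adelicForm L N H).map (adeleToLocal L v)) γ δ) :
    IsConj
      ((localNonsplitEquiv (IsCMField.complexConj L) H (IsCMField.complexConj_ne_one L) w hw γ :
          unitaryGroupOfForm (galAdicCompletionMap (L := L) (IsCMField.complexConj L) hw) (placeForm H w.1)) : GL (Fin N) (w.1.adicCompletion L))
      ((localNonsplitEquiv (IsCMField.complexConj L) H (IsCMField.complexConj_ne_one L) w hw δ :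
          unitaryGroupOfForm (galAdicCompletionMap (L := L) (IsCMField.complexConj L) hw) (placeForm H w.1)) : GL (Fin N) (w.1.adicCompletion L)) := by
  let Ψ : GL (Fin N) (LocalRing L v) →* GL (Fin N) (w.1.adicCompletion L) :=
    Units.map (RingHom.mapMatrix (Pi.evalRingHom (fun w' : PlacesOver L v => w'.1.adicCompletion L) w)).toMonoidHom
  have hΨ : ∀ x : (cmDatum L N H).Local v, Ψ x.val =
      ((localNonsplitEquiv (IsCMField.complexConj L) H (IsCMField.complexConj_ne_one L) w hw x :
          unitaryGroupOfForm (galAdicCompletionMap (L := L) (IsCMField.complexConj L) hw) (placeForm H w.1)) : GL (Fin N) (w.1.adicCompletion L)) :=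
    fun x => Units.ext rfl
  have h0 : IsConj (γ.val : GL (Fin N) (LocalRing L v)) δ.val := h
  have h1 := Ψ.map_isConj h0
  rwa [hΨ, hΨ] at h1

/-- **The `G`-regular locus of `H_v = U(Φ₂)(L⁺_v) × U(Φ₁)(L⁺_v)` is OPEN** at a non-split place (pull-back of the regular locus of `U(Φ₃)(L⁺_v)` along the
continuous `ι_v`, ★ `continuous_endoEmbLocal`). [cite: Rogawski1990, §4.3 p. 42] [cite: PlatonovRapinchuk1994, §3.3] -/
theorem isOpen_setOf_isLocalGRegular (w : PlacesOver L v) (hw : IsCMField.complexConj L • w.1 = w.1) :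
    IsOpen {x : (cmDatum L 2 (Matrix.of fun i j : Fin 2 => if i.val + j.val + 1 = 2 then (1 : L) else 0)).Local v ×
        (cmDatum L 1 (Matrix.of fun i j : Fin 1 => if i.val + j.val + 1 = 1 then (1 : L) else 0)).Local v | IsLocalGRegular L v x} := by
  have hset : {x : (cmDatum L 2 (Matrix.of fun i j : Fin 2 => if i.val + j.val + 1 = 2 then (1 : L) else 0)).Local v ×
        (cmDatum L 1 (Matrix.of fun i j : Fin 1 => if i.val + j.val + 1 = 1 then (1 : L) else 0)).Local v | IsLocalGRegular L v x} =
      endoEmbLocal L v ⁻¹' {g : (cmDatum L 3 (Matrix.of fun i j : Fin 3 => if i.val + j.val + 1 = 3 then (1 : L) else 0)).Local v |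
        IsRegularElt (g.val : GL (Fin 3) (LocalRing L v))} := by
    ext x
    exact Iff.rfl
  rw [hset]
  exact (isOpen_setOf_isRegularElt_cmDatum_local L _ w hw).preimage (continuous_endoEmbLocal L v)

end RegularOpen

/-! ## §2 `G′_v = U(H′)(L⁺_v)`: the torus-coordinate chart datum at a regular point -/

section Gprime

variable {N : ℕ} (H : Matrix (Fin N) (Fin N) L)

/-- Compact-open neighbourhoods inside any neighbourhood, in a locally compact Hausdorff totally disconnected space. [folklore] -/
private theorem exists_isCompact_isOpen_mem_subset_of_mem_nhds' {X : Type*} [TopologicalSpace X] [LocallyCompactSpace X] [T2Space X]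
    [TotallyDisconnectedSpace X] {x : X} {U : Set X} (hU : U ∈ 𝓝 x) :
    ∃ V : Set X, IsCompact V ∧ IsOpen V ∧ x ∈ V ∧ V ⊆ U := by
  obtain ⟨K, hKc, hxK⟩ := WeaklyLocallyCompactSpace.exists_compact_mem_nhds x
  have hx' : x ∈ interior (K ∩ U) := mem_interior_iff_mem_nhds.2 (inter_mem hxK hU)
  obtain ⟨C, hCclopen, hxC, hCsub⟩ :=
    (loc_compact_Haus_tot_disc_of_zero_dim (H := X)).exists_subset_of_mem_open hx' isOpen_interior
  exact ⟨C, hKc.of_isClosed_subset hCclopen.1 (hCsub.trans (interior_subset.trans inter_subset_left)), hCclopen.2, hxC,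
    hCsub.trans (interior_subset.trans inter_subset_right)⟩

set_option maxHeartbeats 1000000 in
/-- **N6ns-reg-(iv) CM DRESS on `G′_v = U(H′)(L⁺_v)`, TORUS COORDINATES.** `H′` with invertible determinant, `v` non-split (`w ∣ v`, `w̄ = w`), `γ₀′ ∈ U(H′)(L⁺_v)` REGULAR
semisimple. There are a topological space `A`, a continuous slice `s : A → G′_v`, an `OpenPartialHomeomorph e : A × ↥Z(γ₀′) → G′_v` with
`e(a, t) = s(a) · t · s(a)⁻¹` on its source and a base point `(a₀, t₀)`, `s(a₀) = 1`, `t₀ = γ₀′`, such that EVERY neighbourhood of `(a₀, t₀)` contains a compact-open box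
`K × B₁ ⊆ e.source` (`a₀ ∈ K`, `t₀ ∈ B₁`) on which: (reg) `t` is regular and `Z(t) = Z(γ₀′)`; (SAT) `x t x⁻¹ ∈ e(K × B₁) ⇒ x ∈ s(K) · Z(γ₀′)`;
(SEP) `t ∼_st t′ ⇒ t = t′`. [cite: Rogawski1990, §3.1 p. 19; §4.3 p. 43; §4.9 p. 54] [cite: HarishChandra1970, Part I §3] -/
theorem exists_chartDatum_cmDatum_local_centralizer (hHd : IsUnit H.det) (w : PlacesOver L v) (hw : IsCMField.complexConj L • w.1 = w.1)
    (γ₀ : (cmDatum L N H).Local v) (hγ₀ : IsRegularElt (γ₀.val : GL (Fin N) (LocalRing L v))) :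
    ∃ (A : Type) (_ : TopologicalSpace A) (s : A → (cmDatum L N H).Local v)
      (e : OpenPartialHomeomorph (A × ↥(Subgroup.centralizer ({γ₀} : Set ((cmDatum L N H).Local v)))) ((cmDatum L N H).Local v))
      (a₀ : A) (t₀ : ↥(Subgroup.centralizer ({γ₀} : Set ((cmDatum L N H).Local v)))),
      Continuous s ∧ s a₀ = 1 ∧ (t₀ : (cmDatum L N H).Local v) = γ₀ ∧ (a₀, t₀) ∈ e.source ∧
      (∀ p ∈ e.source, e p = s p.1 * (p.2 : (cmDatum L N H).Local v) * (s p.1)⁻¹) ∧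
      ∀ O ∈ 𝓝 (a₀, t₀), ∃ (K : Set A) (B₁ : Set ↥(Subgroup.centralizer ({γ₀} : Set ((cmDatum L N H).Local v)))),
        IsCompact K ∧ IsOpen K ∧ a₀ ∈ K ∧ IsCompact B₁ ∧ IsOpen B₁ ∧ t₀ ∈ B₁ ∧ K ×ˢ B₁ ⊆ O ∧ K ×ˢ B₁ ⊆ e.source ∧
        (∀ t ∈ B₁, IsRegularElt ((t : (cmDatum L N H).Local v).val : GL (Fin N) (LocalRing L v)) ∧
          Subgroup.centralizer ({(t : (cmDatum L N H).Local v)} : Set ((cmDatum L N H).Local v)) =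
            Subgroup.centralizer ({γ₀} : Set ((cmDatum L N H).Local v))) ∧
        (∀ t ∈ B₁, ∀ x : (cmDatum L N H).Local v, x * (t : (cmDatum L N H).Local v) * x⁻¹ ∈ e '' (K ×ˢ B₁) →
          x ∈ s '' K * (Subgroup.centralizer ({γ₀} : Set ((cmDatum L N H).Local v)) : Set ((cmDatum L N H).Local v))) ∧
        (∀ t ∈ B₁, ∀ t' ∈ B₁,
          IsStablyConj (conjLocal L (IsCMField.complexConj L) v) ((adelicForm L N H).map (adeleToLocal L v))
            (t : (cmDatum L N H).Local v) (t' : (cmDatum L N H).Local v) → t = t') := by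
  classical
  -- `L_w` as a complete proper totally disconnected non-trivially normed field of characteristic zero
  letI : NontriviallyNormedField (w.1.adicCompletion L) := Valued.toNontriviallyNormedField (w.1.adicCompletion L) (WithZero (Multiplicative ℤ))
  haveI : ProperSpace (w.1.adicCompletion L) := properSpace_adicCompletion L w.1
  haveI : CharZero (w.1.adicCompletion L) := charZero_of_injective_algebraMap (algebraMap L _).injective
  haveI : TotallyDisconnectedSpace (w.1.adicCompletion L) := Valued.totallyDisconnectedSpace'
  -- the one-place model and the regular image point
  set φ := localNonsplitEquiv (IsCMField.complexConj L) H (IsCMField.complexConj_ne_one L) w hw with hφ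
  have hsep : ((((φ γ₀ : unitaryGroupOfForm (galAdicCompletionMap (L := L) (IsCMField.complexConj L) hw) (placeForm H w.1)) :
      GL (Fin N) (w.1.adicCompletion L)) : Matrix (Fin N) (Fin N) (w.1.adicCompletion L)).charpoly).Separable := by
    rw [hφ]
    exact (isRegularElt_iff_charpoly_localNonsplitEquiv L H w hw γ₀).1 hγ₀
  have hJ : IsUnit (placeForm H w.1).det := (Matrix.isUnit_iff_isUnit_det _).1 (isUnit_placeForm_of_isUnit_det hHd w.1)
  -- FILE 1: the Cayley chart datum at `φ γ₀`, and FILE 1b: its torus-coordinate form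
  obtain ⟨s₁, τ₁, e₁, a₀, b₀, -, -, hs₁, hτ₁, -, -, hs₁0, hτ₁0, hcomm₁, -, he₁, hbox₁⟩ :=
    exists_unitary_cayleyChartDatum (galAdicCompletionMap (L := L) (IsCMField.complexConj L) hw)
      (continuous_galAdicCompletionMap L (IsCMField.complexConj L) hw) hJ (φ γ₀) hsep
  haveI : Nonempty _ := ⟨b₀⟩
  obtain ⟨eT, t₁, ht₁, hT₀, heT, hboxT⟩ :=
    exists_torus_chartDatum_of_chartDatum hsep s₁ τ₁ hτ₁ e₁ (fun p _ => he₁ p) hs₁0 hτ₁0 hcomm₁ hbox₁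
  -- transport back along `φ⁻¹`
  obtain ⟨e₂, he₂src, -, he₂, hbox₂⟩ :=
    exists_chartDatum_transport φ.symm s₁ (fun t : ↥(Subgroup.centralizer ({φ γ₀} : Set _)) => (t : _)) eT heT
      (Subgroup.centralizer ({φ γ₀} : Set _))
      (fun u => (((u : GL (Fin N) (w.1.adicCompletion L)) : Matrix (Fin N) (Fin N) (w.1.adicCompletion L)).charpoly).Separable)
      (fun x : (cmDatum L N H).Local v => IsRegularElt (x.val : GL (Fin N) (LocalRing L v)))
      (fun t ht => by
        rw [isRegularElt_iff_charpoly_localNonsplitEquiv L H w hw, ← hφ, φ.apply_symm_apply]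
        exact ht)
      (fun x y => IsConj (x : GL (Fin N) (w.1.adicCompletion L)) (y : GL (Fin N) (w.1.adicCompletion L)))
      (fun x y : (cmDatum L N H).Local v => IsStablyConj (conjLocal L (IsCMField.complexConj L) v) ((adelicForm L N H).map (adeleToLocal L v)) x y)
      (fun t t' h => by
        have h1 := isConj_localNonsplitEquiv_of_isStablyConj L H w hw h
        rwa [← hφ, φ.apply_symm_apply, φ.apply_symm_apply] at h1)
      hboxT
  -- re-coordinatise the torus factor onto `Z(γ₀) ≤ G′_v`
  have hφγ : φ.symm (φ γ₀) = γ₀ := φ.symm_apply_apply γ₀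
  obtain ⟨κ, hκ⟩ := exists_homeomorph_centralizer_map φ.symm (φ γ₀) γ₀ hφγ
  have hTeq : (Subgroup.centralizer ({φ γ₀} : Set _)).map φ.symm.toMulEquiv.toMonoidHom =
      Subgroup.centralizer ({γ₀} : Set ((cmDatum L N H).Local v)) := by
    rw [← centralizer_singleton_map_equiv φ.symm.toMulEquiv (φ γ₀)]
    show Subgroup.centralizer ({φ.symm (φ γ₀)} : Set ((cmDatum L N H).Local v)) = _
    rw [hφγ]
    rfl
  obtain ⟨e₃, he₃src, -, he₃, hbox₃⟩ :=
    exists_chartDatum_recoord κ (fun a => φ.symm (s₁ a)) (fun t : ↥(Subgroup.centralizer ({φ γ₀} : Set _)) => φ.symm (t : _))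
      (fun t : ↥(Subgroup.centralizer ({γ₀} : Set ((cmDatum L N H).Local v))) => (t : (cmDatum L N H).Local v)) hκ e₂ he₂
      ((Subgroup.centralizer ({φ γ₀} : Set _)).map φ.symm.toMulEquiv.toMonoidHom)
      (fun x : (cmDatum L N H).Local v => IsRegularElt (x.val : GL (Fin N) (LocalRing L v)))
      (fun x y : (cmDatum L N H).Local v => IsStablyConj (conjLocal L (IsCMField.complexConj L) v) ((adelicForm L N H).map (adeleToLocal L v)) x y)
      hbox₂
  refine ⟨_, inferInstance, fun a => φ.symm (s₁ a), e₃, a₀, κ t₁, φ.symm.continuous.comp hs₁, ?_, ?_, ?_, he₃, ?_⟩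
  · show φ.symm (s₁ a₀) = 1
    rw [hs₁0, map_one]
  · rw [hκ, ht₁, hφγ]
  · refine (he₃src _).2 ((Set.ext_iff.mp he₂src _).mpr ?_)
    exact (congrArg (fun q => (a₀, q) ∈ eT.source) (κ.symm_apply_apply t₁)).mpr hT₀
  · intro O hO
    obtain ⟨K, B₁, hKc, hKo, haK, hB₁c, hB₁o, htB, hKBO, hKBs, hreg, hsat, hsep⟩ := hbox₃ O hO
    refine ⟨K, B₁, hKc, hKo, haK, hB₁c, hB₁o, htB, hKBO, hKBs, fun t ht => ⟨(hreg t ht).1, (hreg t ht).2.trans hTeq⟩,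
      fun t ht x hx => ?_, hsep⟩
    obtain ⟨y, hy, z, hz, hyz⟩ := Set.mem_mul.1 (hsat t ht x hx)
    exact Set.mem_mul.2 ⟨y, hy, z, hTeq ▸ hz, hyz⟩

end Gprime

/-! ## §3 `H_v = U(Φ₂)(L⁺_v) × U(Φ₁)(L⁺_v)`: the torus-coordinate chart datum at a `G`-regular point -/

section Hside

set_option maxHeartbeats 1000000 in
/-- **N6ns-reg-(iv) CM DRESS on `H_v`, TORUS COORDINATES** (F0P2-p02's junction shape). `v` non-split (`w ∣ v`, `w̄ = w`), `γH ∈ H_v` `G`-REGULAR. There are a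
topological space `A`, a continuous slice `s : A → H_v`, an `OpenPartialHomeomorph e : A × ↥Z_{H_v}(γH) → H_v` with `e(a, t) = s(a) · t · s(a)⁻¹` on its source and a
base point `(a₀, t₀)`, `t₀ = γH`, such that EVERY neighbourhood of `(a₀, t₀)` contains a compact-open box `K × B₁ ⊆ e.source` (`a₀ ∈ K`, `t₀ ∈ B₁`) on which:
(reg) `t` is `G`-regular and `Z(t) = Z(γH)`; (SAT) `x t x⁻¹ ∈ e(K × B₁) ⇒ x ∈ s(K) · Z(γH)`; (SEP-st) `IsLocalStablyConjH L v t t′ ⇒ t = t′` — the binders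
`e s hs τ := Subtype.val he hKB hreg hsat hsep` of ★ `OrbitalIntegralChartRealisation` ∕ the (HLOC) junction. (The `U(Φ₂)`-factor is the transported Cayley chart,
the `U(Φ₁)`-factor — an abelian group — is its own torus coordinate.) [cite: Rogawski1990, §3.1 p. 19; §4.3 p. 43; §4.9 p. 54] [cite: HarishChandra1970, Part I §3] -/
theorem exists_chartDatum_H_local_centralizer (w : PlacesOver L v) (hw : IsCMField.complexConj L • w.1 = w.1)
    (γH : (cmDatum L 2 (Matrix.of fun i j : Fin 2 => if i.val + j.val + 1 = 2 then (1 : L) else 0)).Local v ×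
      (cmDatum L 1 (Matrix.of fun i j : Fin 1 => if i.val + j.val + 1 = 1 then (1 : L) else 0)).Local v)
    (hγH : IsLocalGRegular L v γH) :
    ∃ (A : Type) (_ : TopologicalSpace A)
      (s : A → (cmDatum L 2 (Matrix.of fun i j : Fin 2 => if i.val + j.val + 1 = 2 then (1 : L) else 0)).Local v ×
        (cmDatum L 1 (Matrix.of fun i j : Fin 1 => if i.val + j.val + 1 = 1 then (1 : L) else 0)).Local v)
      (e : OpenPartialHomeomorph
        (A × ↥(Subgroup.centralizer ({γH} : Set ((cmDatum L 2 (Matrix.of fun i j : Fin 2 => if i.val + j.val + 1 = 2 then (1 : L) else 0)).Local v ×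
          (cmDatum L 1 (Matrix.of fun i j : Fin 1 => if i.val + j.val + 1 = 1 then (1 : L) else 0)).Local v))))
        ((cmDatum L 2 (Matrix.of fun i j : Fin 2 => if i.val + j.val + 1 = 2 then (1 : L) else 0)).Local v ×
          (cmDatum L 1 (Matrix.of fun i j : Fin 1 => if i.val + j.val + 1 = 1 then (1 : L) else 0)).Local v))
      (a₀ : A)
      (t₀ : ↥(Subgroup.centralizer ({γH} : Set ((cmDatum L 2 (Matrix.of fun i j : Fin 2 => if i.val + j.val + 1 = 2 then (1 : L) else 0)).Local v ×
          (cmDatum L 1 (Matrix.of fun i j : Fin 1 => if i.val + j.val + 1 = 1 then (1 : L) else 0)).Local v)))),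
      Continuous s ∧
      (t₀ : (cmDatum L 2 (Matrix.of fun i j : Fin 2 => if i.val + j.val + 1 = 2 then (1 : L) else 0)).Local v ×
        (cmDatum L 1 (Matrix.of fun i j : Fin 1 => if i.val + j.val + 1 = 1 then (1 : L) else 0)).Local v) = γH ∧
      (a₀, t₀) ∈ e.source ∧
      (∀ p ∈ e.source, e p = s p.1 * (p.2 : _) * (s p.1)⁻¹) ∧
      ∀ O ∈ 𝓝 (a₀, t₀), ∃ (K : Set A)
        (B₁ : Set ↥(Subgroup.centralizer ({γH} : Set ((cmDatum L 2 (Matrix.of fun i j : Fin 2 => if i.val + j.val + 1 = 2 then (1 : L) else 0)).Local v ×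
          (cmDatum L 1 (Matrix.of fun i j : Fin 1 => if i.val + j.val + 1 = 1 then (1 : L) else 0)).Local v)))),
        IsCompact K ∧ IsOpen K ∧ a₀ ∈ K ∧ IsCompact B₁ ∧ IsOpen B₁ ∧ t₀ ∈ B₁ ∧ K ×ˢ B₁ ⊆ O ∧ K ×ˢ B₁ ⊆ e.source ∧
        (∀ t ∈ B₁, IsLocalGRegular L v (t : _) ∧
          Subgroup.centralizer ({(t : (cmDatum L 2 (Matrix.of fun i j : Fin 2 => if i.val + j.val + 1 = 2 then (1 : L) else 0)).Local v ×
            (cmDatum L 1 (Matrix.of fun i j : Fin 1 => if i.val + j.val + 1 = 1 then (1 : L) else 0)).Local v)} : Set _) =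
            Subgroup.centralizer ({γH} : Set _)) ∧
        (∀ t ∈ B₁, ∀ x : (cmDatum L 2 (Matrix.of fun i j : Fin 2 => if i.val + j.val + 1 = 2 then (1 : L) else 0)).Local v ×
            (cmDatum L 1 (Matrix.of fun i j : Fin 1 => if i.val + j.val + 1 = 1 then (1 : L) else 0)).Local v,
          x * (t : _) * x⁻¹ ∈ e '' (K ×ˢ B₁) →
            x ∈ s '' K * (Subgroup.centralizer ({γH} : Set ((cmDatum L 2 (Matrix.of fun i j : Fin 2 => if i.val + j.val + 1 = 2 then (1 : L) else 0)).Local v ×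
              (cmDatum L 1 (Matrix.of fun i j : Fin 1 => if i.val + j.val + 1 = 1 then (1 : L) else 0)).Local v)) : Set _)) ∧
        (∀ t ∈ B₁, ∀ t' ∈ B₁, IsLocalStablyConjH L v (t : _) (t' : _) → t = t') := by
  classical
  obtain ⟨γ₂, u₀⟩ := γH
  -- `L_w` as a complete proper totally disconnected non-trivially normed field of characteristic zero
  letI : NontriviallyNormedField (w.1.adicCompletion L) := Valued.toNontriviallyNormedField (w.1.adicCompletion L) (WithZero (Multiplicative ℤ))
  haveI : ProperSpace (w.1.adicCompletion L) := properSpace_adicCompletion L w.1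
  haveI : CharZero (w.1.adicCompletion L) := charZero_of_injective_algebraMap (algebraMap L _).injective
  haveI : TotallyDisconnectedSpace (w.1.adicCompletion L) := Valued.totallyDisconnectedSpace'
  -- the one-place model of the `U(Φ₂)`-factor and the regular image point
  set φ := localNonsplitEquiv (IsCMField.complexConj L) (Matrix.of fun i j : Fin 2 => if i.val + j.val + 1 = 2 then (1 : L) else 0)
    (IsCMField.complexConj_ne_one L) w hw with hφ
  have hreg₂ : IsRegularElt (γ₂.val : GL (Fin 2) (LocalRing L v)) := isRegularElt_fst_of_isLocalGRegular L v (γ₂, u₀) hγH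
  have hsep : ((((φ γ₂ : unitaryGroupOfForm (galAdicCompletionMap (L := L) (IsCMField.complexConj L) hw)
      (placeForm (Matrix.of fun i j : Fin 2 => if i.val + j.val + 1 = 2 then (1 : L) else 0) w.1)) :
      GL (Fin 2) (w.1.adicCompletion L)) : Matrix (Fin 2) (Fin 2) (w.1.adicCompletion L)).charpoly).Separable := by
    rw [hφ]
    exact (isRegularElt_iff_charpoly_localNonsplitEquiv L _ w hw γ₂).1 hreg₂
  have hJ : IsUnit (placeForm (Matrix.of fun i j : Fin 2 => if i.val + j.val + 1 = 2 then (1 : L) else 0) w.1).det :=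
    (Matrix.isUnit_iff_isUnit_det _).1 (isUnit_placeForm_of_isUnit_det (isUnit_antidiagOne_det (L := L) (N := 2)) w.1)
  -- FILE 1 at `φ γ₂`, FILE 1b torus form, transport along `φ⁻¹`
  obtain ⟨s₁, τ₁, e₁, a₀, b₀, -, -, hs₁, hτ₁, -, -, hs₁0, hτ₁0, hcomm₁, -, he₁, hbox₁⟩ :=
    exists_unitary_cayleyChartDatum (galAdicCompletionMap (L := L) (IsCMField.complexConj L) hw)
      (continuous_galAdicCompletionMap L (IsCMField.complexConj L) hw) hJ (φ γ₂) hsep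
  haveI : Nonempty _ := ⟨b₀⟩
  obtain ⟨eT, t₁, ht₁, hT₀, heT, hboxT⟩ :=
    exists_torus_chartDatum_of_chartDatum hsep s₁ τ₁ hτ₁ e₁ (fun p _ => he₁ p) hs₁0 hτ₁0 hcomm₁ hbox₁
  obtain ⟨e₂, he₂src, -, he₂, hbox₂⟩ :=
    exists_chartDatum_transport φ.symm s₁ (fun t : ↥(Subgroup.centralizer ({φ γ₂} : Set _)) => (t : _)) eT heT
      (Subgroup.centralizer ({φ γ₂} : Set _))
      (fun u => (((u : GL (Fin 2) (w.1.adicCompletion L)) : Matrix (Fin 2) (Fin 2) (w.1.adicCompletion L)).charpoly).Separable)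
      (fun _ => True) (fun _ _ => trivial)
      (fun x y => IsConj (x : GL (Fin 2) (w.1.adicCompletion L)) (y : GL (Fin 2) (w.1.adicCompletion L)))
      (fun x y : (cmDatum L 2 (Matrix.of fun i j : Fin 2 => if i.val + j.val + 1 = 2 then (1 : L) else 0)).Local v =>
        IsStablyConj (conjLocal L (IsCMField.complexConj L) v)
          ((adelicForm L 2 (Matrix.of fun i j : Fin 2 => if i.val + j.val + 1 = 2 then (1 : L) else 0)).map (adeleToLocal L v)) x y)
      (fun t t' h => by
        have h1 := isConj_localNonsplitEquiv_of_isStablyConj L _ w hw h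
        rwa [← hφ, φ.apply_symm_apply, φ.apply_symm_apply] at h1)
      hboxT
  have hφγ : φ.symm (φ γ₂) = γ₂ := φ.symm_apply_apply γ₂
  have hTeq : (Subgroup.centralizer ({φ γ₂} : Set _)).map φ.symm.toMulEquiv.toMonoidHom =
      Subgroup.centralizer ({γ₂} : Set ((cmDatum L 2 (Matrix.of fun i j : Fin 2 => if i.val + j.val + 1 = 2 then (1 : L) else 0)).Local v)) := by
    rw [← centralizer_singleton_map_equiv φ.symm.toMulEquiv (φ γ₂)]
    show Subgroup.centralizer ({φ.symm (φ γ₂)} : Set _) = _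
    rw [hφγ]
    rfl
  -- the abelian factor `U(Φ₁)(L⁺_v)`
  have hcomm1 : ∀ x y : (cmDatum L 1 (Matrix.of fun i j : Fin 1 => if i.val + j.val + 1 = 1 then (1 : L) else 0)).Local v, x * y = y * x :=
    fun x y => Subtype.ext (gl_fin_one_comm _ _)
  haveI : TotallyDisconnectedSpace ((cmDatum L 1 (Matrix.of fun i j : Fin 1 => if i.val + j.val + 1 = 1 then (1 : L) else 0)).Local v) :=
    totallyDisconnectedSpace_cmDatum_local L 1 _ v
  have hU : ∀ N ∈ 𝓝 u₀, ∃ C : Set ((cmDatum L 1 (Matrix.of fun i j : Fin 1 => if i.val + j.val + 1 = 1 then (1 : L) else 0)).Local v),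
      IsCompact C ∧ IsOpen C ∧ u₀ ∈ C ∧ C ⊆ N := fun N hN => exists_isCompact_isOpen_mem_subset_of_mem_nhds' hN
  have hP₀ : IsLocalGRegular L v (φ.symm ((t₁ : ↥(Subgroup.centralizer ({φ γ₂} : Set _))) : _), u₀) := by
    rw [ht₁, hφγ]
    exact hγH
  -- the product datum in coordinates `Z(φ γ₂) × U(Φ₁)(L⁺_v)`
  have h₀' : (a₀, t₁) ∈ e₂.source := (Set.ext_iff.mp he₂src (a₀, t₁)).mpr hT₀
  have hst : ∀ x y : (cmDatum L 2 (Matrix.of fun i j : Fin 2 => if i.val + j.val + 1 = 2 then (1 : L) else 0)).Local v ×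
      (cmDatum L 1 (Matrix.of fun i j : Fin 1 => if i.val + j.val + 1 = 1 then (1 : L) else 0)).Local v,
      IsLocalStablyConjH L v x y →
        IsStablyConj (conjLocal L (IsCMField.complexConj L) v)
          ((adelicForm L 2 (Matrix.of fun i j : Fin 2 => if i.val + j.val + 1 = 2 then (1 : L) else 0)).map (adeleToLocal L v)) x.1 y.1 ∧ x.2 = y.2 :=
    fun x y h => ⟨h.1, isStablyConj_iff_eq_of_fin_one.1 h.2⟩
  obtain ⟨s, τ, e, hsdef, hτdef, hsc, -, h₀, -, he, hbox⟩ :=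
    exists_chartDatum_prod hcomm1 e₂ (fun a => φ.symm (s₁ a)) (φ.symm.continuous.comp hs₁)
      (fun t : ↥(Subgroup.centralizer ({φ γ₂} : Set _)) => φ.symm (t : _)) (φ.symm.continuous.comp continuous_subtype_val) he₂
      h₀' ((Subgroup.centralizer ({φ γ₂} : Set _)).map φ.symm.toMulEquiv.toMonoidHom) (fun _ => True)
      (fun x y : (cmDatum L 2 (Matrix.of fun i j : Fin 2 => if i.val + j.val + 1 = 2 then (1 : L) else 0)).Local v =>
        IsStablyConj (conjLocal L (IsCMField.complexConj L) v)
          ((adelicForm L 2 (Matrix.of fun i j : Fin 2 => if i.val + j.val + 1 = 2 then (1 : L) else 0)).map (adeleToLocal L v)) x y)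
      hbox₂ hU (fun x => IsLocalGRegular L v x) (isOpen_setOf_isLocalGRegular L w hw) hP₀ (IsLocalStablyConjH L v) hst
  -- re-coordinatise onto `Z_{H_v}((γ₂, u₀))`
  obtain ⟨κ, hκ⟩ := exists_homeomorph_centralizer_prod hcomm1 φ.symm (φ γ₂) γ₂ hφγ u₀
  have hττ' : ∀ q, ((κ q : ↥(Subgroup.centralizer ({(γ₂, u₀)} : Set _))) : _) = τ q := fun q => by rw [hκ, hτdef]
  obtain ⟨e₃, he₃src, -, he₃, hbox₃⟩ :=
    exists_chartDatum_recoord κ s τ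
      (fun t : ↥(Subgroup.centralizer ({(γ₂, u₀)} : Set _)) =>
        (t : (cmDatum L 2 (Matrix.of fun i j : Fin 2 => if i.val + j.val + 1 = 2 then (1 : L) else 0)).Local v ×
          (cmDatum L 1 (Matrix.of fun i j : Fin 1 => if i.val + j.val + 1 = 1 then (1 : L) else 0)).Local v)) hττ' e he
      (((Subgroup.centralizer ({φ γ₂} : Set _)).map φ.symm.toMulEquiv.toMonoidHom).prod ⊤) (fun x => IsLocalGRegular L v x)
      (IsLocalStablyConjH L v) hbox
  have hTfin : ((Subgroup.centralizer ({φ γ₂} : Set _)).map φ.symm.toMulEquiv.toMonoidHom).prod ⊤ =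
      Subgroup.centralizer ({(γ₂, u₀)} : Set ((cmDatum L 2 (Matrix.of fun i j : Fin 2 => if i.val + j.val + 1 = 2 then (1 : L) else 0)).Local v ×
        (cmDatum L 1 (Matrix.of fun i j : Fin 1 => if i.val + j.val + 1 = 1 then (1 : L) else 0)).Local v)) := by
    rw [hTeq, centralizer_singleton_prod_of_comm hcomm1]
    rfl
  refine ⟨_, inferInstance, s, e₃, a₀, κ (t₁, u₀), hsc, ?_, ?_, he₃, ?_⟩
  · rw [hκ]
    show (φ.symm (t₁ : _), u₀) = (γ₂, u₀)
    rw [ht₁, hφγ]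
    rfl
  · refine (he₃src _).2 ?_
    exact (congrArg (fun q => (a₀, q) ∈ e.source) (κ.symm_apply_apply (t₁, u₀))).mpr h₀
  · intro O hO
    obtain ⟨K, B₁, hKc, hKo, haK, hB₁c, hB₁o, htB, hKBO, hKBs, hreg, hsat, hsep⟩ := hbox₃ O hO
    refine ⟨K, B₁, hKc, hKo, haK, hB₁c, hB₁o, htB, hKBO, hKBs, fun t ht => ⟨(hreg t ht).1, (hreg t ht).2.trans hTfin⟩,
      fun t ht x hx => ?_, hsep⟩
    obtain ⟨y, hy, z, hz, hyz⟩ := Set.mem_mul.1 (hsat t ht x hx)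
    exact Set.mem_mul.2 ⟨y, hy, z, hTfin ▸ hz, hyz⟩

end Hside

/-! ## §4 The consumer's binder shapes (F0P2-p02 (g8) `LocalTransferChartJunctionCM`, binders `hNG` and `hchartH`, VERBATIM) -/

section Consumer

variable {N : ℕ} (H : Matrix (Fin N) (Fin N) L)

/-- **(1ᵀ) in the junction's `hNG` shape**: the `G′_v`-chart in the coordinates of `T = Z_{G′_v}(γ₀)` with `s_G(a_G) = 1`, `b₀ = γ₀`, and ARBITRARILY SMALL compact-open
boxes on which every point is regular and `GL_N(∏_{w′∣v} L_{w′})`-conjugate box points coincide (from ★ `exists_chartDatum_cmDatum_local_centralizer`, dropping the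
saturation and centraliser clauses; `IsStablyConj` unfolds to `IsConj` of the underlying invertible matrices). [cite: Rogawski1990, §3.1 p. 19; §4.9 p. 54] -/
theorem exists_chartDatum_cmDatum_local_centralizer_regular_sep (hHd : IsUnit H.det) (w : PlacesOver L v)
    (hw : IsCMField.complexConj L • w.1 = w.1) (γ₀ : (cmDatum L N H).Local v) (hγ₀ : IsRegularElt (γ₀.val : GL (Fin N) (LocalRing L v))) :
    ∃ (A : Type) (_ : TopologicalSpace A) (s : A → (cmDatum L N H).Local v)
      (e : OpenPartialHomeomorph (A × ↥(Subgroup.centralizer ({γ₀} : Set ((cmDatum L N H).Local v)))) ((cmDatum L N H).Local v))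
      (a₀ : A) (t₀ : ↥(Subgroup.centralizer ({γ₀} : Set ((cmDatum L N H).Local v)))),
      (∀ p ∈ e.source, e p = s p.1 * (p.2 : (cmDatum L N H).Local v) * (s p.1)⁻¹) ∧ s a₀ = 1 ∧ (t₀ : (cmDatum L N H).Local v) = γ₀ ∧
      ∀ O ∈ 𝓝 (a₀, t₀), ∃ (K : Set A) (B : Set ↥(Subgroup.centralizer ({γ₀} : Set ((cmDatum L N H).Local v)))),
        IsCompact K ∧ IsOpen K ∧ a₀ ∈ K ∧ IsCompact B ∧ IsOpen B ∧ t₀ ∈ B ∧ K ×ˢ B ⊆ O ∧ K ×ˢ B ⊆ e.source ∧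
        (∀ b ∈ B, IsRegularElt ((b : (cmDatum L N H).Local v).val : GL (Fin N) (LocalRing L v))) ∧
        (∀ b ∈ B, ∀ b' ∈ B, IsConj ((b : (cmDatum L N H).Local v).val : GL (Fin N) (LocalRing L v)) (b' : (cmDatum L N H).Local v).val → b = b') := by
  obtain ⟨A, iA, s, e, a₀, t₀, -, hs₀, ht₀, -, he, hbox⟩ := exists_chartDatum_cmDatum_local_centralizer L H hHd w hw γ₀ hγ₀
  refine ⟨A, iA, s, e, a₀, t₀, he, hs₀, ht₀, fun O hO => ?_⟩
  obtain ⟨K, B₁, hKc, hKo, haK, hB₁c, hB₁o, htB, hKBO, hKBs, hreg, -, hsep⟩ := hbox O hO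
  exact ⟨K, B₁, hKc, hKo, haK, hB₁c, hB₁o, htB, hKBO, hKBs, fun b hb => (hreg b hb).1, fun b hb b' hb' h => hsep b hb b' hb' h⟩

/-- **(2ᵀ) in the junction's `hchartH` shape**: for EVERY `G`-regular `γH ∈ H_v`, ONE compact-open box `K × B₁ ∋ (a₀, γH)` of the torus-coordinate chart with
regularity, common centraliser, saturation and stable separation (from ★ `exists_chartDatum_H_local_centralizer` at the whole space as neighbourhood).
[cite: Rogawski1990, §3.1 p. 19; §4.3 p. 43; §4.9 p. 54] -/
theorem forall_isLocalGRegular_exists_chartDatum_H_local_centralizer (w : PlacesOver L v) (hw : IsCMField.complexConj L • w.1 = w.1) :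
    ∀ γH : (cmDatum L 2 (Matrix.of fun i j : Fin 2 => if i.val + j.val + 1 = 2 then (1 : L) else 0)).Local v ×
        (cmDatum L 1 (Matrix.of fun i j : Fin 1 => if i.val + j.val + 1 = 1 then (1 : L) else 0)).Local v, IsLocalGRegular L v γH →
      ∃ (A : Type) (_ : TopologicalSpace A)
        (s : A → (cmDatum L 2 (Matrix.of fun i j : Fin 2 => if i.val + j.val + 1 = 2 then (1 : L) else 0)).Local v ×
          (cmDatum L 1 (Matrix.of fun i j : Fin 1 => if i.val + j.val + 1 = 1 then (1 : L) else 0)).Local v)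
        (e : OpenPartialHomeomorph
          (A × ↥(Subgroup.centralizer ({γH} : Set ((cmDatum L 2 (Matrix.of fun i j : Fin 2 => if i.val + j.val + 1 = 2 then (1 : L) else 0)).Local v ×
            (cmDatum L 1 (Matrix.of fun i j : Fin 1 => if i.val + j.val + 1 = 1 then (1 : L) else 0)).Local v))))
          ((cmDatum L 2 (Matrix.of fun i j : Fin 2 => if i.val + j.val + 1 = 2 then (1 : L) else 0)).Local v ×
            (cmDatum L 1 (Matrix.of fun i j : Fin 1 => if i.val + j.val + 1 = 1 then (1 : L) else 0)).Local v))
        (K : Set A)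
        (B₁ : Set ↥(Subgroup.centralizer ({γH} : Set ((cmDatum L 2 (Matrix.of fun i j : Fin 2 => if i.val + j.val + 1 = 2 then (1 : L) else 0)).Local v ×
            (cmDatum L 1 (Matrix.of fun i j : Fin 1 => if i.val + j.val + 1 = 1 then (1 : L) else 0)).Local v))))
        (a₀ : A)
        (b₀ : ↥(Subgroup.centralizer ({γH} : Set ((cmDatum L 2 (Matrix.of fun i j : Fin 2 => if i.val + j.val + 1 = 2 then (1 : L) else 0)).Local v ×
            (cmDatum L 1 (Matrix.of fun i j : Fin 1 => if i.val + j.val + 1 = 1 then (1 : L) else 0)).Local v)))),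
        Continuous s ∧ (∀ p ∈ e.source, e p = s p.1 * (p.2 : _) * (s p.1)⁻¹) ∧ IsCompact K ∧ IsOpen K ∧ a₀ ∈ K ∧ IsOpen B₁ ∧
        (b₀ : (cmDatum L 2 (Matrix.of fun i j : Fin 2 => if i.val + j.val + 1 = 2 then (1 : L) else 0)).Local v ×
          (cmDatum L 1 (Matrix.of fun i j : Fin 1 => if i.val + j.val + 1 = 1 then (1 : L) else 0)).Local v) = γH ∧ b₀ ∈ B₁ ∧ K ×ˢ B₁ ⊆ e.source ∧
        (∀ b ∈ B₁, IsLocalGRegular L v (b : _) ∧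
          Subgroup.centralizer ({(b : (cmDatum L 2 (Matrix.of fun i j : Fin 2 => if i.val + j.val + 1 = 2 then (1 : L) else 0)).Local v ×
            (cmDatum L 1 (Matrix.of fun i j : Fin 1 => if i.val + j.val + 1 = 1 then (1 : L) else 0)).Local v)} : Set _) =
            Subgroup.centralizer ({γH} : Set _)) ∧
        (∀ b ∈ B₁, ∀ x : (cmDatum L 2 (Matrix.of fun i j : Fin 2 => if i.val + j.val + 1 = 2 then (1 : L) else 0)).Local v ×
            (cmDatum L 1 (Matrix.of fun i j : Fin 1 => if i.val + j.val + 1 = 1 then (1 : L) else 0)).Local v,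
          x * (b : _) * x⁻¹ ∈ e '' (K ×ˢ B₁) →
            x ∈ s '' K * (Subgroup.centralizer ({γH} : Set ((cmDatum L 2 (Matrix.of fun i j : Fin 2 => if i.val + j.val + 1 = 2 then (1 : L) else 0)).Local v ×
              (cmDatum L 1 (Matrix.of fun i j : Fin 1 => if i.val + j.val + 1 = 1 then (1 : L) else 0)).Local v)) : Set _)) ∧
        (∀ b ∈ B₁, ∀ b' ∈ B₁, IsLocalStablyConjH L v (b : _) (b' : _) → b = b') := by
  intro γH hγH
  obtain ⟨A, iA, s, e, a₀, t₀, hs, ht₀, -, he, hbox⟩ := exists_chartDatum_H_local_centralizer L w hw γH hγH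
  obtain ⟨K, B₁, hKc, hKo, haK, -, hB₁o, htB, -, hKBs, hreg, hsat, hsep⟩ := hbox Set.univ Filter.univ_mem
  exact ⟨A, iA, s, e, K, B₁, a₀, t₀, hs, he, hKc, hKo, haK, hB₁o, ht₀, htB, hKBs, hreg, hsat, hsep⟩

end Consumer

end Literature.NumberTheory.Rogawski1990

end
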